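import Literature.MathematicalPhysics.KineticTheory.RegularStationaryState
import Literature.Analysis.FunctionSpaces.PoissonPointProcessUniqueness
import Literature.Analysis.FunctionSpaces.PointConfigVagueTopology
import Mathlib.Topology.ContinuousMap.StoneWeierstrass
import Mathlib.MeasureTheory.Measure.HasOuterApproxClosed
import Mathlib.Topology.UrysohnsLemma
import Mathlib.Topology.GDelta.MetrizableSpace
import Mathlib.Topology.Metrizable.Urysohn
import Literature.MathematicalPhysics.KineticTheory.PointProcessVagueCompactness
import HarnessLib

/-!
# Kallenberg's Lemma 12.1: the Laplace functional determines the law of a simple point process — `LaplaceFunctionalDeterminesLaw` HOLDS (re-homed proofs)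

**Kallenberg 2002, Lemma 12.1 — the Laplace functional determines the law of a point process; the named fact
`Literature.MathematicalPhysics.KineticTheory.PointProcess.LaplaceFunctionalDeterminesLaw` (`PointProcessVagueCompactness.lean`) HOLDS**:
two finite laws on the locally finite simple configurations `PointConfig X` of a locally compact second countable Hausdorff space `X` (count
σ-algebra) whose Laplace functionals `E[exp(−Σ_{p∈ω} f p)]` agree for every continuous compactly supported `f ≥ 0` are equal (O. Kallenberg,
*Foundations of Modern Probability*, 2nd ed. 2002, Lemma 12.1 (i) with Thm. A2.3 [Kallenberg2002]).  ARCHITECTURE of the in-tree proof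
(kernel-checked, 0 cited facts; until now Summits-side only,
`Summits/AtomisticToContinuum/HydrodynamicLimit/Theorems/AntiMazurCoboundariesCorrectorPressureDecayTangentTightnessHolds.lean`): CORE — linear
statistics `sumFn` of finitely many test functions and their moments, measurability of the counts `ω ↦ #(ω ∩ K)` of compact sets as monotone
limits of linear statistics, the π-system `compactCountEvents` of count cylinders of compact sets and the fact that it generates the count
σ-algebra, `laplaceFunctional` at `0`, and the identity `∫ Π (sumFn)^n · exp(−sumFn) dμ` from the Laplace functional; UNIQUENESS — the joint law of
`(exp(−sumFn f₁), …, exp(−sumFn f_m))` on `[0,1]^m` is determined through Stone–Weierstrass (polynomials in the coordinates are Laplace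
functionals of nonnegative combinations), whence the laws of the count vectors of compact sets agree (outer approximation of compact sets by
Urysohn functions, monotone limits), and a π-λ argument on the count cylinders closes.  RE-HOMED into `Literature/` by the Hodge foundations lane
(`lit-hodgefound`, seat p20, generation 38): verbatim DECLARATION-LEVEL ports of the 2 Summits modules
`…/Theorems/AntiMazurCoboundariesCorrectorPressureDecayTangentTightnessLaplaceUniqueness{Core (11), ∅ (8)}.lean`, namespace
`Summit.AtomisticToContinuum.HydrodynamicLimit.Theorems.KiferCompactification` re-rooted as
`Literature.MathematicalPhysics.KineticTheory.PointProcess.LaplaceUniqueness` (the in-tree name `stub_laplaceFunctionalDeterminesLaw` kept, it is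
a proved theorem), followed by the EXACT-name discharge `Literature.MathematicalPhysics.KineticTheory.PointProcess.LaplaceFunctionalDeterminesLaw_holds`.
Theorem-only file: no definition, no new named fact (D-0026), no Summits import; built on the tree's Literature layer
(`MathematicalPhysics/KineticTheory/{RegularStationaryState, PointProcessVagueCompactness}`, `Analysis/FunctionSpaces/{PoissonPointProcessUniqueness,
PointConfigVagueTopology}`) and Mathlib (Stone–Weierstrass, Urysohn, outer-regular approximation).  The Summits originals stay in place (transitional
duplication).  WHAT THIS IS NOT: only part (i) of Lemma 12.1 on SIMPLE configurations (the fact's own `TODO(general form)`); nothing about random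
measures with multiplicities or avoidance functions, and nothing about the hydrodynamic-limit route that uses it.
-/

noncomputable section

/-!
## Part 1 — port of `Summits/AtomisticToContinuum/HydrodynamicLimit/Theorems/AntiMazurCoboundariesCorrectorPressureDecayTangentTightnessLaplaceUniquenessCore.lean` (11 declarations kept)

# Tangent tightness, IV-a: compact count events and mixed moments of linear statistics 

Core (measure-theoretic) half of the proof of the registered stub `stub_laplaceFunctionalDeterminesLaw`
(`…TangentTightnessLaplaceUniqueness.lean`; Kallenberg, *Foundations of Modern Probability* (2002), Lemma 12.1 for
the tree's locally finite simple configurations `PointConfig X` with their count σ-algebra), namespace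
`Summit.AtomisticToContinuum.HydrodynamicLimit.Theorems.KiferCompactification`:

* `sumFn_eq_sum_inter`, `sumFn_sum_natCast_mul`: linear statistics `S_f(ω) = ∑_{p ∈ ω} f p` of `f` supported in a
  compact `L` are finite sums over `ω ∩ L`; `S_{∑ nₖ fₖ} = ∑ nₖ S_{fₖ}`;
* `sumFn_pow_succ_facts`: for `g : X → [0,1]` compactly supported with `K = g⁻¹{1}`, `S_{g^{n+1}}(ω) ↓ N_ω(K)`
  (counts of compact sets are monotone limits of linear statistics);
* `measurable_of_measurable_count_isCompact`: a map into configurations is measurable as soon as the counts of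
  compact sets are (λ-system argument on `X` run through the finite counting measures `(ω.toMeasure)|_L`,
  `Measurable.measure_of_isPiSystem`, then the compact exhaustion);
* `isPiSystem_compactCountEvents`, `stub_generateFrom_compactCountEvents` (REGISTERED helper stub): the events
  `{N(K₁) < t₁, …, N(Kₘ) < tₘ}` over compact sets form a π-system generating the count σ-algebra (Kallenberg
  Thm. A2.3: the σ-algebra of counting measures is generated by the counts of compact sets);
* `integral_prod_pow_exp_neg_sumFn_eq`: under equality of Laplace functionals on `C_c⁺`, all mixed moments of
  `(e^{-S_{f₁}}, …, e^{-S_{fₘ}})` agree (they are Laplace functionals at `∑ nₖ fₖ`); `laplaceFunctional_zero`.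

References: O. Kallenberg, *Foundations of Modern Probability*, 2nd ed. (2002), Lemma 12.1, Thm. A2.3;
D. J. Daley, D. Vere-Jones, *An Introduction to the Theory of Point Processes* II (2008), §9.1, Thm. 9.4.V.

(Verbatim declaration-level port — the declarations listed in the Part header count — of the Summits-side module of the
AtomisticToContinuum/HydrodynamicLimit tree (Kifer compactification, tangent tightness); route / stub / lead bookkeeping in the text above is historical.)
-/

section Part1

open _root_.MeasureTheory _root_.Set _root_.Filter _root_.Topology _root_.Function
open scoped _root_.ENNReal _root_.NNReal BoundedContinuousFunction

namespace Literature.MathematicalPhysics.KineticTheory.PointProcess.LaplaceUniqueness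

open Literature.Analysis.FunctionSpaces (PointConfig)
open Literature.MathematicalPhysics.KineticTheory.PointProcess (laplaceFunctional measurable_exp_neg_finsum)

variable {X : Type*} [TopologicalSpace X]

/-! ## Linear statistics as finite sums -/

/-- For `f` supported in a compact set `L`, the linear statistic `∑_{p ∈ ω} f p` is the finite sum over the
points of `ω` in `L`. [cite: Kallenberg2002, Lemma 12.1] -/
theorem sumFn_eq_sum_inter (ω : PointConfig X) {L : Set X} (hL : IsCompact L) {f : X → ℝ}
    (hf : support f ⊆ L) :
    ω.sumFn f = ∑ p ∈ (ω.finite_inter_isCompact L hL).toFinset, f p := by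
  refine finsum_mem_eq_sum_of_subset f ?_ ?_
  · intro p hp
    rw [Finite.coe_toFinset]
    exact ⟨hp.1, hf hp.2⟩
  · intro p hp
    rw [Finite.coe_toFinset] at hp
    exact hp.1

/-- Linear statistics of nonnegative-integer combinations of compactly supported functions:
`S_{∑ₖ nₖ fₖ} = ∑ₖ nₖ S_{fₖ}`. [cite: Kallenberg2002, Lemma 12.1] -/
theorem sumFn_sum_natCast_mul {κ : Type*} [Fintype κ] (ω : PointConfig X) {f : κ → X → ℝ}
    (hcs : ∀ k, HasCompactSupport (f k)) (n : κ → ℕ) :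
    ω.sumFn (fun x => ∑ k, (n k : ℝ) * f k x) = ∑ k, (n k : ℝ) * ω.sumFn (f k) := by
  have hL : IsCompact (⋃ k, tsupport (f k)) := isCompact_iUnion fun k => (hcs k).isCompact
  have hsub : ∀ k, support (f k) ⊆ ⋃ k, tsupport (f k) := fun k =>
    (subset_tsupport _).trans (subset_iUnion (fun k => tsupport (f k)) k)
  have hsub' : support (fun x => ∑ k, (n k : ℝ) * f k x) ⊆ ⋃ k, tsupport (f k) := by
    intro x hx
    obtain ⟨k, -, hk⟩ := Finset.exists_ne_zero_of_sum_ne_zero hx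
    exact hsub k (right_ne_zero_of_mul hk)
  rw [sumFn_eq_sum_inter ω hL hsub', Finset.sum_comm]
  refine Finset.sum_congr rfl fun k _ => ?_
  rw [sumFn_eq_sum_inter ω hL (hsub k), Finset.mul_sum]

/-! ## Counts of compact sets as monotone limits of linear statistics -/

/-- Pointwise monotone approximation of counts: for `g : X → [0,1]` with compact support and `K = g⁻¹{1}`, the
linear statistics `S_{g^{n+1}}(ω)` decrease (in `n`) to the number of points of `ω` in `K`; in particular
`S_{g^{n+1}}(ω) < t` forces `N_ω(K) < t`, and `N_ω(K) < t` forces `S_{g^{n+1}}(ω) < t` eventually.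
[cite: Kallenberg2002, Lemma 12.1] -/
theorem sumFn_pow_succ_facts (ω : PointConfig X) {K : Set X} {g : X → ℝ} (hgK : K = g ⁻¹' {1})
    (hgc : HasCompactSupport g) (hg01 : ∀ x, g x ∈ Icc (0 : ℝ) 1) (t : ℕ) :
    (Antitone fun n : ℕ => ω.sumFn fun x => g x ^ (n + 1)) ∧
      (∀ n : ℕ, (ω.sumFn fun x => g x ^ (n + 1)) < t → ω.count K < (t : ℕ∞)) ∧
        (ω.count K < (t : ℕ∞) → ∀ᶠ n : ℕ in atTop, (ω.sumFn fun x => g x ^ (n + 1)) < t) := by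
  classical
  -- the points of `ω` in the support of `g`
  set T : Finset X := (ω.finite_inter_isCompact _ hgc.isCompact).toFinset with hT
  have hsupp : ∀ n : ℕ, support (fun x => g x ^ (n + 1)) ⊆ tsupport g := fun n x hx =>
    subset_tsupport _ fun h' => hx (by simp [h'])
  have hu : ∀ n : ℕ, (ω.sumFn fun x => g x ^ (n + 1)) = ∑ p ∈ T, g p ^ (n + 1) := fun n =>
    sumFn_eq_sum_inter ω hgc.isCompact (hsupp n)
  have hg1 : ∀ {p}, p ∈ K → g p = 1 := fun hp => by rwa [hgK] at hp
  have hKL : K ⊆ tsupport g := fun p hp => subset_tsupport _ (by simp [mem_support, hg1 hp])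
  -- the number of points in `K`
  have hKT : ω.carrier ∩ K = ↑(T.filter (· ∈ K)) := by
    ext p
    simp only [hT, Finset.coe_filter, Finite.mem_toFinset, mem_inter_iff, mem_setOf_eq]
    exact ⟨fun h => ⟨⟨h.1, hKL h.2⟩, h.2⟩, fun h => ⟨h.1.1, h.2⟩⟩
  have hcount : ω.count K = ((T.filter (· ∈ K)).card : ℕ∞) := by
    rw [PointConfig.count, hKT, encard_coe_eq_coe_finsetCard]
  -- convergence and domination of the finite sums
  have htend : Tendsto (fun n : ℕ => ∑ p ∈ T, g p ^ (n + 1)) atTop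
      (𝓝 ((T.filter (· ∈ K)).card : ℝ)) := by
    rw [← Finset.sum_boole]  -- may need adjusting
    refine tendsto_finsetSum T fun p _ => ?_
    by_cases hp : p ∈ K
    · simp [hg1 hp, hp]
    · have hne : g p ≠ 1 := by rwa [hgK] at hp
      simp only [hp, if_false]
      exact (tendsto_pow_atTop_nhds_zero_of_lt_one (hg01 p).1 (lt_of_le_of_ne (hg01 p).2 hne)).comp
        (tendsto_add_atTop_nat 1)
  have hle : ∀ n : ℕ, ((T.filter (· ∈ K)).card : ℝ) ≤ ∑ p ∈ T, g p ^ (n + 1) := by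
    intro n
    rw [← Finset.sum_boole]
    refine Finset.sum_le_sum fun p _ => ?_
    by_cases hp : p ∈ K
    · simp [hg1 hp, hp]
    · simp only [hp, if_false]
      exact pow_nonneg (hg01 p).1 _
  refine ⟨?_, ?_, ?_⟩
  · intro m n hmn
    show (ω.sumFn fun x => g x ^ (n + 1)) ≤ ω.sumFn fun x => g x ^ (m + 1)
    rw [hu, hu]
    exact Finset.sum_le_sum fun p _ => pow_le_pow_of_le_one (hg01 p).1 (hg01 p).2 (by omega)
  · intro n hn
    rw [hu n] at hn
    have h' : ((T.filter (· ∈ K)).card : ℝ) < t := (hle n).trans_lt hn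
    rw [hcount]
    exact_mod_cast h'
  · intro hlt
    rw [hcount] at hlt
    have h' : ((T.filter (· ∈ K)).card : ℝ) < t := by exact_mod_cast hlt
    exact (htend.eventually_lt_const h').mono fun n hn => by rwa [hu n]

/-! ## Measurability from the counts of compact sets -/

section MeasurableOfCompact

variable [T2Space X] [SigmaCompactSpace X] [MeasurableSpace X] [BorelSpace X]

/-- An `ℕ∞`-valued map is measurable as soon as its composition with the coercion to `ℝ≥0∞` is.
[cite: Kallenberg2002, Lemma 12.1] -/
private theorem measurable_of_measurable_toENNReal {Ω : Type*} [MeasurableSpace Ω] {g : Ω → ℕ∞}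
    (hg : Measurable fun a => ((g a : ℕ∞) : ℝ≥0∞)) : Measurable g :=
  measurable_to_countable' fun n => by
    have h : g ⁻¹' {n} = (fun a => ((g a : ℕ∞) : ℝ≥0∞)) ⁻¹' {(n : ℝ≥0∞)} := by
      ext a
      simp only [mem_preimage, mem_singleton_iff, ENat.toENNReal_inj]
    rw [h]
    exact hg (measurableSet_singleton _)

/-- Counts in the traces `s ∩ L` of Borel sets `s` on a fixed compact set `L` are measurable as soon as the
counts of compact sets are: a λ-system argument on `X` (closed sets generate the Borel σ-algebra and meet `L`
in compact sets), run through the finite counting measures `a ↦ ((c a).toMeasure)|_L`.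
[cite: Kallenberg2002, Lemma 12.1] -/
theorem measurable_count_inter_of_isCompact {Ω : Type*} [MeasurableSpace Ω] {c : Ω → PointConfig X}
    (h : ∀ K, IsCompact K → Measurable fun a => (c a).count K) {L : Set X} (hL : IsCompact L)
    {s : Set X} (hs : MeasurableSet s) : Measurable fun a => (c a).count (s ∩ L) := by
  haveI hfin : ∀ a, IsFiniteMeasure (((c a).toMeasure).restrict L) := fun a => by
    refine ⟨?_⟩
    rw [Measure.restrict_apply MeasurableSet.univ, univ_inter,
      PointConfig.toMeasure_apply _ hL.measurableSet, ENat.toENNReal_lt_top]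
    exact (c a).count_lt_top_of_isCompact hL
  have hμ : Measurable fun a => ((c a).toMeasure).restrict L := by
    refine Measurable.measure_of_isPiSystem
      ((BorelSpace.measurable_eq (α := X)).trans borel_eq_generateFrom_isClosed) isPiSystem_isClosed
      (fun F hF => ?_) ?_
    · have hF' : IsClosed F := hF
      have hmeas : MeasurableSet F := hF'.measurableSet
      simp_rw [Measure.restrict_apply hmeas,
        PointConfig.toMeasure_apply _ (hmeas.inter hL.measurableSet)]
      exact measurable_from_top.comp (h _ (hL.inter_left hF'))
    · simp_rw [Measure.restrict_apply MeasurableSet.univ, univ_inter,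
        PointConfig.toMeasure_apply _ hL.measurableSet]
      exact measurable_from_top.comp (h _ hL)
  have h1 : Measurable fun a => ((c a).toMeasure).restrict L s := (Measure.measurable_coe hs).comp hμ
  simp_rw [Measure.restrict_apply hs, PointConfig.toMeasure_apply _ (hs.inter hL.measurableSet)] at h1
  exact measurable_of_measurable_toENNReal h1

/-- **A map into configurations is measurable as soon as the counts of compact sets are**: on a σ-compact
Hausdorff space the count σ-algebra of `PointConfig X` is generated by the counts of compact sets (counts of
Borel sets inside a compact `L` by `measurable_count_inter_of_isCompact`, then `N(s) = supₖ N(s ∩ Lₖ)` along the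
compact exhaustion). [cite: Kallenberg2002, Lemma 12.1] -/
theorem measurable_of_measurable_count_isCompact {Ω : Type*} [MeasurableSpace Ω]
    {c : Ω → PointConfig X} (h : ∀ K, IsCompact K → Measurable fun a => (c a).count K) :
    Measurable c := by
  refine PointConfig.measurable_of_count fun s hs => ?_
  have hG : ∀ n k : ℕ, MeasurableSet {a | (n : ℕ∞) ≤ (c a).count (s ∩ compactCovering X k)} :=
    fun n k => measurable_count_inter_of_isCompact h (isCompact_compactCovering X k) hs
      (show MeasurableSet {v : ℕ∞ | (n : ℕ∞) ≤ v} from (Set.to_countable _).measurableSet)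
  have hG' : ∀ n : ℕ, MeasurableSet {a | (n : ℕ∞) ≤ (c a).count s} := by
    intro n
    have : {a | (n : ℕ∞) ≤ (c a).count s} =
        ⋃ k, {a | (n : ℕ∞) ≤ (c a).count (s ∩ compactCovering X k)} := by
      ext a
      simp only [mem_setOf_eq, mem_iUnion]
      exact (c a).natCast_le_count_iff_exists s (compactCovering_subset X) (iUnion_compactCovering X) n
    rw [this]
    exact MeasurableSet.iUnion fun k => hG n k
  refine ENat.measurable_iff.2 fun n => ?_
  have : (fun a => (c a).count s) ⁻¹' {(n : ℕ∞)} =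
      {a | (n : ℕ∞) ≤ (c a).count s} \ {a | ((n + 1 : ℕ) : ℕ∞) ≤ (c a).count s} := by
    ext a
    simp only [mem_preimage, mem_singleton_iff, Set.mem_sdiff, mem_setOf_eq, not_le, Nat.cast_add,
      Nat.cast_one]
    constructor
    · intro ha
      rw [ha]
      exact ⟨le_rfl, by exact_mod_cast Nat.lt_succ_self n⟩
    · rintro ⟨h1, h2⟩
      exact le_antisymm ((ENat.lt_add_one_iff (ENat.coe_ne_top n)).1 h2) h1
  rw [this]
  exact (hG' n).diff (hG' (n + 1))

end MeasurableOfCompact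

/-! ## The compact count events: a generating π-system -/

section Cylinders

/-- The events `{N(K₁) < t₁, …, N(Kₘ) < tₘ}` over finitely many compact sets form a π-system (concatenate the
two families). [cite: Kallenberg2002, Lemma 12.1] -/
theorem isPiSystem_compactCountEvents :
    IsPiSystem {A : Set (PointConfig X) | ∃ (κ : Type) (_ : Fintype κ) (K : κ → Set X) (t : κ → ℕ),
      (∀ k, IsCompact (K k)) ∧ A = {ω | ∀ k, ω.count (K k) < (t k : ℕ∞)}} := by
  rintro A ⟨κ, hκ, K, t, hK, rfl⟩ A' ⟨κ', hκ', K', t', hK', rfl⟩ -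
  refine ⟨κ ⊕ κ', inferInstance, Sum.elim K K', Sum.elim t t', ?_, ?_⟩
  · rintro (k | k)
    · exact hK k
    · exact hK' k
  · ext ω
    simp only [mem_inter_iff, mem_setOf_eq, Sum.forall, Sum.elim_inl, Sum.elim_inr]

variable [MeasurableSpace X]

/-- Compact count events are measurable for the count σ-algebra. [cite: Kallenberg2002, Lemma 12.1] -/
theorem measurableSet_of_mem_compactCountEvents [T2Space X] [OpensMeasurableSpace X]
    {A : Set (PointConfig X)}
    (hA : A ∈ {A : Set (PointConfig X) | ∃ (κ : Type) (_ : Fintype κ) (K : κ → Set X) (t : κ → ℕ),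
      (∀ k, IsCompact (K k)) ∧ A = {ω | ∀ k, ω.count (K k) < (t k : ℕ∞)}}) :
    MeasurableSet A := by
  obtain ⟨κ, hκ, K, t, hK, rfl⟩ := hA
  rw [Set.setOf_forall]
  exact MeasurableSet.iInter fun k =>
    PointConfig.measurable_count (hK k).measurableSet
      (show MeasurableSet {v : ℕ∞ | v < (t k : ℕ∞)} from (Set.to_countable _).measurableSet)

/-- **The compact count events generate the count σ-algebra** of `PointConfig X`, for `X` σ-compact Hausdorff
with its Borel σ-algebra (`{N(K) = n} = {N(K) < n + 1} \ {N(K) < n}` and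
`measurable_of_measurable_count_isCompact`). [cite: Kallenberg2002, Lemma 12.1] -/
theorem generateFrom_compactCountEvents [T2Space X] [SigmaCompactSpace X] [BorelSpace X] :
    MeasurableSpace.generateFrom {A : Set (PointConfig X) | ∃ (κ : Type) (_ : Fintype κ) (K : κ → Set X)
      (t : κ → ℕ), (∀ k, IsCompact (K k)) ∧ A = {ω | ∀ k, ω.count (K k) < (t k : ℕ∞)}} =
      (PointConfig.instMeasurableSpace : MeasurableSpace (PointConfig X)) := by
  apply le_antisymm
  · exact MeasurableSpace.generateFrom_le fun A hA => measurableSet_of_mem_compactCountEvents hA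
  · set C := {A : Set (PointConfig X) | ∃ (κ : Type) (_ : Fintype κ) (K : κ → Set X)
      (t : κ → ℕ), (∀ k, IsCompact (K k)) ∧ A = {ω | ∀ k, ω.count (K k) < (t k : ℕ∞)}} with hC
    -- counts of compact sets are measurable for the generated σ-algebra
    have hK : ∀ K, IsCompact K →
        Measurable[MeasurableSpace.generateFrom C] fun ω : PointConfig X => ω.count K := by
      intro K hK
      have hlt : ∀ m : ℕ,
          MeasurableSet[MeasurableSpace.generateFrom C] {ω : PointConfig X | ω.count K < (m : ℕ∞)} := by
        intro m
        refine MeasurableSpace.measurableSet_generateFrom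
          ⟨Unit, inferInstance, fun _ => K, fun _ => m, fun _ => hK, ?_⟩
        ext ω
        simp
      refine (@ENat.measurable_iff _ (MeasurableSpace.generateFrom C) _).2 fun n => ?_
      have : (fun ω : PointConfig X => ω.count K) ⁻¹' {(n : ℕ∞)} =
          {ω | ω.count K < ((n + 1 : ℕ) : ℕ∞)} \ {ω | ω.count K < (n : ℕ∞)} := by
        ext ω
        simp only [mem_preimage, mem_singleton_iff, Set.mem_sdiff, mem_setOf_eq, not_lt, Nat.cast_add,
          Nat.cast_one]
        constructor
        · intro hω
          rw [hω]
          exact ⟨by exact_mod_cast Nat.lt_succ_self n, le_rfl⟩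
        · rintro ⟨h1, h2⟩
          exact le_antisymm ((ENat.lt_add_one_iff (ENat.coe_ne_top n)).1 h1) h2
      rw [this]
      exact (hlt (n + 1)).diff (hlt n)
    have hid := @measurable_of_measurable_count_isCompact X _ _ _ _ _ (PointConfig X)
      (MeasurableSpace.generateFrom C) id hK
    intro s hs
    exact hid hs

end Cylinders

/-! ## Mixed moments of the exponential statistics -/

section Moments

variable [MeasurableSpace X] {μ ν : Measure (PointConfig X)}

/-- The Laplace functional at `f = 0` is the total mass. [cite: Kallenberg2002, Lemma 12.1] -/
theorem laplaceFunctional_zero (ρ : Measure (PointConfig X)) :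
    laplaceFunctional ρ (0 : X → ℝ) = ρ.real univ := by
  simp [laplaceFunctional]

/-- Under the Laplace hypothesis the mixed moments of `(e^{-S_{f_k}})_k` agree under `μ` and `ν`: they are the
Laplace functionals at `∑ₖ nₖ fₖ ∈ C_c⁺`. [cite: Kallenberg2002, Lemma 12.1] -/
theorem integral_prod_pow_exp_neg_sumFn_eq {κ : Type*} [Fintype κ]
    (hL : ∀ f : X → ℝ, Continuous f → HasCompactSupport f → (∀ x, 0 ≤ f x) →
      laplaceFunctional μ f = laplaceFunctional ν f)
    {f : κ → X → ℝ} (hf : ∀ k, Continuous (f k)) (hcs : ∀ k, HasCompactSupport (f k))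
    (h0 : ∀ k x, 0 ≤ f k x) (n : κ → ℕ) :
    ∫ ω, ∏ k, Real.exp (-(ω.sumFn (f k))) ^ n k ∂μ =
      ∫ ω, ∏ k, Real.exp (-(ω.sumFn (f k))) ^ n k ∂ν := by
  set g : X → ℝ := fun x => ∑ k, (n k : ℝ) * f k x with hg
  have hgc : Continuous g := continuous_finsetSum _ fun k _ => continuous_const.mul (hf k)
  have hgs : HasCompactSupport g := by
    refine HasCompactSupport.intro' (isCompact_iUnion fun k => (hcs k).isCompact)
      (isClosed_iUnion_of_finite fun k => isClosed_tsupport _) fun x hx => ?_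
    refine Finset.sum_eq_zero fun k _ => ?_
    have hxk : x ∉ tsupport (f k) := fun h' => hx (mem_iUnion.2 ⟨k, h'⟩)
    rw [image_eq_zero_of_notMem_tsupport hxk, mul_zero]
  have hg0 : ∀ x, 0 ≤ g x := fun x => Finset.sum_nonneg fun k _ => mul_nonneg (Nat.cast_nonneg _) (h0 k x)
  have hpt : ∀ ω : PointConfig X,
      ∏ k, Real.exp (-(ω.sumFn (f k))) ^ n k = Real.exp (-(ω.sumFn g)) := by
    intro ω
    rw [hg, sumFn_sum_natCast_mul ω hcs n, ← Finset.sum_neg_distrib, Real.exp_sum]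
    refine Finset.prod_congr rfl fun k _ => ?_
    rw [← Real.exp_nat_mul, mul_neg]
  simp_rw [hpt]
  exact hL g hgc hgs hg0

end Moments

end Literature.MathematicalPhysics.KineticTheory.PointProcess.LaplaceUniqueness

end Part1

/-!
## Part 2 — port of `Summits/AtomisticToContinuum/HydrodynamicLimit/Theorems/AntiMazurCoboundariesCorrectorPressureDecayTangentTightnessLaplaceUniqueness.lean` (8 declarations kept)

# Tangent tightness, IV: the Laplace functional determines the law of a point process 

Registered stub `stub_laplaceFunctionalDeterminesLaw` of line `FirstLemma` (idea `kifer-compactification`),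
namespace `Summit.AtomisticToContinuum.HydrodynamicLimit.Theorems.KiferCompactification`: the UNFOLDED body of
the named fact `LaplaceFunctionalDeterminesLaw` (Kallenberg, *Foundations of Modern Probability* (2002),
Lemma 12.1) for the tree's locally finite simple configurations `PointConfig X` with their count σ-algebra:
two finite laws `μ, ν` on `PointConfig X` (`X` locally compact, second countable, Hausdorff, Borel) whose Laplace
functionals `E[exp(-∑_{p ∈ ω} f p)]` agree for all continuous compactly supported `f ≥ 0` are equal.

Proof (Kallenberg L12.1 / Daley–Vere-Jones II 9.4.V), on top of `…TangentTightnessLaplaceUniquenessCore.lean`: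
* (a) joint laws of linear statistics: with `f = ∑ₖ nₖ fₖ` the hypothesis gives equality of all mixed moments
  of `Z = (e^{-S_{f₁}}, …, e^{-S_{fₘ}}) ∈ [0,1]^m` (`S_f ω = ∑_{p ∈ ω} f p`; Core file), hence of `∫ p(Z)` for every
  polynomial `p` in the coordinates, hence (STONE–WEIERSTRASS on the cube,
  `ContinuousMap.exists_mem_subalgebra_near_continuous_of_isCompact_of_separatesPoints`) of `∫ g(Z)` for every
  bounded continuous `g`, hence `Z_* μ = Z_* ν` (`ext_of_forall_integral_eq_of_IsFiniteMeasure`): `map_exp_neg_sumFn_eq`;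
* (b) counts of compact sets: `K = g⁻¹{1}` for some `g ∈ C_c(X, [0,1])` (`K` is `Gδ`, `X` being metrizable:
  `exists_continuous_one_zero_of_isCompact_of_isGδ`), and `S_{g^{n+1}}(ω) ↓ N_ω(K)` (Core file), so
  `{N(K₁) < t₁, …, N(Kₘ) < tₘ}` is the increasing union of the events `{S_{g₁^{n+1}} < t₁, …}` of (a):
  `measure_compactCountEvent_eq`;
* (c) these compact count events form a π-system generating the count σ-algebra (Core file:
  `isPiSystem_compactCountEvents`, `generateFrom_compactCountEvents`) and `μ univ = ν univ` (`f = 0`), so `μ = ν`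
  by `MeasureTheory.ext_of_generate_finite`.

References: O. Kallenberg, *Foundations of Modern Probability*, 2nd ed. (2002), Lemma 12.1, Thm. A2.3;
D. J. Daley, D. Vere-Jones, *An Introduction to the Theory of Point Processes* II (2008), Thm. 9.4.V.

(Verbatim declaration-level port — the declarations listed in the Part header count — of the Summits-side module of the
AtomisticToContinuum/HydrodynamicLimit tree (Kifer compactification, tangent tightness); route / stub / lead bookkeeping in the text above is historical.)
-/

section Part2

open _root_.MeasureTheory _root_.Set _root_.Filter _root_.Topology _root_.Function
open scoped _root_.ENNReal _root_.NNReal BoundedContinuousFunction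

namespace Literature.MathematicalPhysics.KineticTheory.PointProcess.LaplaceUniqueness

open Literature.Analysis.FunctionSpaces (PointConfig)
open Literature.MathematicalPhysics.KineticTheory.PointProcess (laplaceFunctional measurable_exp_neg_finsum)

variable {X : Type*} [TopologicalSpace X]

/-! ## Joint laws of linear statistics (Stone–Weierstrass) -/

section Laplace

variable [T2Space X] [LocallyCompactSpace X] [SecondCountableTopology X] [MeasurableSpace X] [BorelSpace X]
  {μ ν : Measure (PointConfig X)} [IsFiniteMeasure μ] [IsFiniteMeasure ν]

/-- The vector `(e^{-S_{f_k}(ω)})_k` of a finite family of continuous compactly supported `f_k ≥ 0` is a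
measurable map into `κ → ℝ`. [cite: Kallenberg2002, Lemma 12.1] -/
theorem measurable_exp_neg_sumFn_pi {κ : Type*} [Fintype κ] {f : κ → X → ℝ} (hf : ∀ k, Continuous (f k))
    (hcs : ∀ k, HasCompactSupport (f k)) (h0 : ∀ k x, 0 ≤ f k x) :
    Measurable fun (ω : PointConfig X) (k : κ) => Real.exp (-(ω.sumFn (f k))) :=
  measurable_pi_lambda _ fun k => measurable_exp_neg_finsum (hf k).measurable (hcs k) (h0 k)

/-- The monomials `x ↦ ∏ₖ (x k)^{nₖ}` exhaust the submonoid of `C(κ → ℝ, ℝ)` generated by the coordinates.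
[cite: Kallenberg2002, Lemma 12.1] -/
private theorem exists_eq_prod_pow_of_mem_closure {κ : Type*} [Fintype κ] {q : C(κ → ℝ, ℝ)}
    (hq : q ∈ Submonoid.closure
      (Set.range fun k : κ => (⟨fun x => x k, continuous_apply k⟩ : C(κ → ℝ, ℝ)))) :
    ∃ n : κ → ℕ, ∀ x, q x = ∏ k, x k ^ n k := by
  classical
  induction hq using Submonoid.closure_induction with
  | mem q hq =>
    obtain ⟨k, rfl⟩ := hq
    refine ⟨Pi.single k 1, fun x => ?_⟩
    rw [Finset.prod_eq_single k (fun j _ hj => by rw [Pi.single_eq_of_ne hj, pow_zero])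
      (fun h => absurd (Finset.mem_univ k) h)]
    simp
  | one => exact ⟨0, fun x => by simp⟩
  | mul q q' _ _ ih ih' =>
    obtain ⟨n, hn⟩ := ih
    obtain ⟨n', hn'⟩ := ih'
    refine ⟨n + n', fun x => ?_⟩
    rw [ContinuousMap.mul_apply, hn, hn', ← Finset.prod_mul_distrib]
    refine Finset.prod_congr rfl fun k _ => ?_
    rw [Pi.add_apply, pow_add]

/-- Under the Laplace hypothesis, `∫ p(e^{-S_{f₁}}, …, e^{-S_{fₘ}})` agree under `μ` and `ν` for every polynomial
`p` in the coordinates (linear span of the monomials). [cite: Kallenberg2002, Lemma 12.1] -/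
private theorem integral_comp_eq_of_mem_adjoin {κ : Type*} [Fintype κ]
    (hL : ∀ f : X → ℝ, Continuous f → HasCompactSupport f → (∀ x, 0 ≤ f x) →
      laplaceFunctional μ f = laplaceFunctional ν f)
    {f : κ → X → ℝ} (hf : ∀ k, Continuous (f k)) (hcs : ∀ k, HasCompactSupport (f k))
    (h0 : ∀ k x, 0 ≤ f k x) {p : C(κ → ℝ, ℝ)}
    (hp : p ∈ Algebra.adjoin ℝ
      (Set.range fun k : κ => (⟨fun x => x k, continuous_apply k⟩ : C(κ → ℝ, ℝ)))) :
    Integrable (fun ω : PointConfig X => p fun k => Real.exp (-(ω.sumFn (f k)))) μ ∧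
      Integrable (fun ω : PointConfig X => p fun k => Real.exp (-(ω.sumFn (f k)))) ν ∧
        ∫ ω, p (fun k => Real.exp (-(ω.sumFn (f k)))) ∂μ =
          ∫ ω, p (fun k => Real.exp (-(ω.sumFn (f k)))) ∂ν := by
  have hZ := measurable_exp_neg_sumFn_pi hf hcs h0
  have hp' : p ∈ Submodule.span ℝ ((Submonoid.closure (Set.range fun k : κ =>
      (⟨fun x => x k, continuous_apply k⟩ : C(κ → ℝ, ℝ))) : Set C(κ → ℝ, ℝ))) := by
    rw [← Algebra.adjoin_eq_span]
    exact hp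
  clear hp
  induction hp' using Submodule.span_induction with
  | mem q hq =>
    obtain ⟨n, hn⟩ := exists_eq_prod_pow_of_mem_closure hq
    have hqZ : ∀ ω : PointConfig X, q (fun k => Real.exp (-(ω.sumFn (f k)))) =
        ∏ k, Real.exp (-(ω.sumFn (f k))) ^ n k := fun ω => hn _
    have hmeas : ∀ ρ : Measure (PointConfig X),
        AEStronglyMeasurable (fun ω : PointConfig X => q fun k => Real.exp (-(ω.sumFn (f k)))) ρ :=
      fun ρ => (q.continuous.measurable.comp hZ).aestronglyMeasurable
    have hbd : ∀ ω : PointConfig X, ‖q fun k => Real.exp (-(ω.sumFn (f k)))‖ ≤ 1 := by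
      intro ω
      rw [hqZ, Real.norm_eq_abs,
        abs_of_nonneg (Finset.prod_nonneg fun k _ => pow_nonneg (Real.exp_nonneg _) _)]
      exact Finset.prod_le_one (fun k _ => pow_nonneg (Real.exp_nonneg _) _) fun k _ =>
        pow_le_one₀ (Real.exp_nonneg _)
          (Real.exp_le_one_iff.2 (neg_nonpos.2 (PointConfig.sumFn_nonneg _ (h0 k))))
    refine ⟨Integrable.of_bound (hmeas μ) 1 (ae_of_all _ hbd),
      Integrable.of_bound (hmeas ν) 1 (ae_of_all _ hbd), ?_⟩
    simp_rw [hqZ]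
    exact integral_prod_pow_exp_neg_sumFn_eq hL hf hcs h0 n
  | zero => simp
  | add q q' _ _ ih ih' =>
    obtain ⟨h1, h2, h3⟩ := ih
    obtain ⟨h1', h2', h3'⟩ := ih'
    simp only [ContinuousMap.add_apply]
    exact ⟨h1.add h1', h2.add h2', by rw [integral_add h1 h1', integral_add h2 h2', h3, h3']⟩
  | smul a q _ ih =>
    obtain ⟨h1, h2, h3⟩ := ih
    simp only [ContinuousMap.smul_apply, smul_eq_mul]
    exact ⟨h1.const_mul a, h2.const_mul a, by rw [integral_const_mul, integral_const_mul, h3]⟩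

/-- **Stone–Weierstrass step.** Under the Laplace hypothesis, `∫ g(e^{-S_{f₁}}, …, e^{-S_{fₘ}})` agree under `μ`
and `ν` for every bounded continuous `g` on `κ → ℝ`: polynomials in the coordinates separate points, hence
approximate `g` uniformly on the cube `[0,1]^κ` where the vector takes its values.
[cite: Kallenberg2002, Lemma 12.1] -/
theorem integral_comp_exp_neg_sumFn_eq {κ : Type*} [Fintype κ]
    (hL : ∀ f : X → ℝ, Continuous f → HasCompactSupport f → (∀ x, 0 ≤ f x) →
      laplaceFunctional μ f = laplaceFunctional ν f)
    {f : κ → X → ℝ} (hf : ∀ k, Continuous (f k)) (hcs : ∀ k, HasCompactSupport (f k))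
    (h0 : ∀ k x, 0 ≤ f k x) (g : (κ → ℝ) →ᵇ ℝ) :
    ∫ ω, g (fun k => Real.exp (-(ω.sumFn (f k)))) ∂μ =
      ∫ ω, g (fun k => Real.exp (-(ω.sumFn (f k)))) ∂ν := by
  set A : Subalgebra ℝ C(κ → ℝ, ℝ) := Algebra.adjoin ℝ
    (Set.range fun k : κ => (⟨fun x => x k, continuous_apply k⟩ : C(κ → ℝ, ℝ))) with hA_def
  have hA : A.SeparatesPoints := by
    intro x y hxy
    obtain ⟨k, hk⟩ := Function.ne_iff.1 hxy
    exact ⟨_, ⟨_, Algebra.subset_adjoin ⟨k, rfl⟩, rfl⟩, hk⟩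
  have hZ := measurable_exp_neg_sumFn_pi hf hcs h0
  have hZmem : ∀ ω : PointConfig X,
      (fun k => Real.exp (-(ω.sumFn (f k)))) ∈ Set.pi univ fun _ : κ => Icc (0 : ℝ) 1 :=
    fun ω => mem_univ_pi.2 fun k =>
      ⟨Real.exp_nonneg _, Real.exp_le_one_iff.2 (neg_nonpos.2 (ω.sumFn_nonneg (h0 k)))⟩
  have hgi : ∀ (ρ : Measure (PointConfig X)) [IsFiniteMeasure ρ],
      Integrable (fun ω : PointConfig X => g fun k => Real.exp (-(ω.sumFn (f k)))) ρ :=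
    fun ρ _ => Integrable.of_bound (g.continuous.measurable.comp hZ).aestronglyMeasurable ‖g‖
      (ae_of_all _ fun ω => g.norm_coe_le_norm _)
  refine eq_of_forall_dist_le fun ε hε => ?_
  have hM : 0 < μ.real univ + ν.real univ + 1 := by positivity
  obtain ⟨p, hpA, hp⟩ := ContinuousMap.exists_mem_subalgebra_near_continuous_of_isCompact_of_separatesPoints hA
    g.toContinuousMap (isCompact_univ_pi fun _ : κ => isCompact_Icc) (div_pos hε hM)
  obtain ⟨hpμ, hpν, hpeq⟩ := integral_comp_eq_of_mem_adjoin hL hf hcs h0 hpA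
  have key : ∀ (ρ : Measure (PointConfig X)) [IsFiniteMeasure ρ],
      Integrable (fun ω : PointConfig X => p fun k => Real.exp (-(ω.sumFn (f k)))) ρ →
        ‖∫ ω, g (fun k => Real.exp (-(ω.sumFn (f k)))) ∂ρ -
            ∫ ω, p (fun k => Real.exp (-(ω.sumFn (f k)))) ∂ρ‖ ≤
          ε / (μ.real univ + ν.real univ + 1) * ρ.real univ := by
    intro ρ _ hpρ
    rw [← integral_sub (hgi ρ) hpρ]
    refine norm_integral_le_of_norm_le_const (ae_of_all _ fun ω => ?_)
    rw [norm_sub_rev]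
    exact (hp _ (hZmem ω)).le
  have h1 := key μ hpμ
  have h2 := key ν hpν
  rw [dist_eq_norm]
  calc ‖∫ ω, g (fun k => Real.exp (-(ω.sumFn (f k)))) ∂μ -
        ∫ ω, g (fun k => Real.exp (-(ω.sumFn (f k)))) ∂ν‖
      = ‖(∫ ω, g (fun k => Real.exp (-(ω.sumFn (f k)))) ∂μ -
            ∫ ω, p (fun k => Real.exp (-(ω.sumFn (f k)))) ∂μ) -
          (∫ ω, g (fun k => Real.exp (-(ω.sumFn (f k)))) ∂ν -
            ∫ ω, p (fun k => Real.exp (-(ω.sumFn (f k)))) ∂ν)‖ := by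
        rw [hpeq, sub_sub_sub_cancel_right]
    _ ≤ ε / (μ.real univ + ν.real univ + 1) * μ.real univ +
          ε / (μ.real univ + ν.real univ + 1) * ν.real univ := (norm_sub_le _ _).trans (add_le_add h1 h2)
    _ ≤ ε := by
        rw [← mul_add, div_mul_eq_mul_div, div_le_iff₀ hM]
        nlinarith [measureReal_nonneg (μ := μ) (s := univ), measureReal_nonneg (μ := ν) (s := univ)]

/-- **Joint laws of finitely many linear statistics agree** (Kallenberg L12.1, first step): under the Laplace
hypothesis, the laws of `(e^{-S_{f₁}}, …, e^{-S_{fₘ}})` under `μ` and `ν` coincide as Borel measures on `κ → ℝ`.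
[cite: Kallenberg2002, Lemma 12.1] -/
theorem map_exp_neg_sumFn_eq {κ : Type*} [Fintype κ]
    (hL : ∀ f : X → ℝ, Continuous f → HasCompactSupport f → (∀ x, 0 ≤ f x) →
      laplaceFunctional μ f = laplaceFunctional ν f)
    {f : κ → X → ℝ} (hf : ∀ k, Continuous (f k)) (hcs : ∀ k, HasCompactSupport (f k))
    (h0 : ∀ k x, 0 ≤ f k x) :
    μ.map (fun (ω : PointConfig X) (k : κ) => Real.exp (-(ω.sumFn (f k)))) =
      ν.map (fun (ω : PointConfig X) (k : κ) => Real.exp (-(ω.sumFn (f k)))) := by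
  have hZ := measurable_exp_neg_sumFn_pi hf hcs h0
  refine ext_of_forall_integral_eq_of_IsFiniteMeasure fun g => ?_
  rw [integral_map hZ.aemeasurable g.continuous.aestronglyMeasurable,
    integral_map hZ.aemeasurable g.continuous.aestronglyMeasurable]
  exact integral_comp_exp_neg_sumFn_eq hL hf hcs h0 g

/-- Under the Laplace hypothesis the events `{S_{f₁} < t₁, …, S_{fₘ} < tₘ}` have the same mass.
[cite: Kallenberg2002, Lemma 12.1] -/
theorem measure_setOf_forall_sumFn_lt_eq {κ : Type*} [Fintype κ]
    (hL : ∀ f : X → ℝ, Continuous f → HasCompactSupport f → (∀ x, 0 ≤ f x) →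
      laplaceFunctional μ f = laplaceFunctional ν f)
    {f : κ → X → ℝ} (hf : ∀ k, Continuous (f k)) (hcs : ∀ k, HasCompactSupport (f k))
    (h0 : ∀ k x, 0 ≤ f k x) (t : κ → ℝ) :
    μ {ω | ∀ k, ω.sumFn (f k) < t k} = ν {ω | ∀ k, ω.sumFn (f k) < t k} := by
  have hZ := measurable_exp_neg_sumFn_pi hf hcs h0
  have hB : MeasurableSet {x : κ → ℝ | ∀ k, Real.exp (-t k) < x k} := by
    rw [Set.setOf_forall]
    exact MeasurableSet.iInter fun k => measurableSet_lt measurable_const (measurable_pi_apply k)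
  have hset : {ω : PointConfig X | ∀ k, ω.sumFn (f k) < t k} =
      (fun (ω : PointConfig X) (k : κ) => Real.exp (-(ω.sumFn (f k)))) ⁻¹'
        {x | ∀ k, Real.exp (-t k) < x k} := by
    ext ω
    simp only [mem_setOf_eq, mem_preimage, Real.exp_lt_exp, neg_lt_neg_iff]
  rw [hset, ← Measure.map_apply hZ hB, ← Measure.map_apply hZ hB, map_exp_neg_sumFn_eq hL hf hcs h0]

/-! ## Counts of compact sets from linear statistics -/

/-- **Counts of compact sets have the same joint laws** (Kallenberg L12.1, second step): under the Laplace
hypothesis, `μ {N(K₁) < t₁, …, N(Kₘ) < tₘ} = ν {…}` for compact `Kₖ` — the event is the increasing union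
of the events `{S_{g₁^{n+1}} < t₁, …, S_{gₘ^{n+1}} < tₘ}` (`gₖ ∈ C_c(X, [0,1])` with `Kₖ = gₖ⁻¹{1}`, which exist
since compact sets are `Gδ` in the metrizable space `X`), whose masses agree by `measure_setOf_forall_sumFn_lt_eq`.
[cite: Kallenberg2002, Lemma 12.1] -/
theorem measure_compactCountEvent_eq {κ : Type*} [Fintype κ]
    (hL : ∀ f : X → ℝ, Continuous f → HasCompactSupport f → (∀ x, 0 ≤ f x) →
      laplaceFunctional μ f = laplaceFunctional ν f)
    {K : κ → Set X} (hK : ∀ k, IsCompact (K k)) (t : κ → ℕ) :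
    μ {ω | ∀ k, ω.count (K k) < (t k : ℕ∞)} = ν {ω | ∀ k, ω.count (K k) < (t k : ℕ∞)} := by
  -- Urysohn functions with `K k = g k ⁻¹' {1}`
  have hg : ∀ k, ∃ g : C(X, ℝ), K k = g ⁻¹' {1} ∧ HasCompactSupport g ∧ ∀ x, g x ∈ Icc (0 : ℝ) 1 := by
    intro k
    obtain ⟨g, h1, -, h2, h3⟩ := exists_continuous_one_zero_of_isCompact_of_isGδ (hK k)
      (hK k).isClosed.isGδ isClosed_empty (disjoint_empty _)
    exact ⟨g, h1, h2, h3⟩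
  choose g hgK hgc hg01 using hg
  -- the approximating events
  set A : ℕ → Set (PointConfig X) :=
    fun n => {ω | ∀ k, (ω.sumFn fun x => g k x ^ (n + 1)) < t k} with hA
  have hAeq : ∀ n, μ (A n) = ν (A n) := fun n =>
    measure_setOf_forall_sumFn_lt_eq hL (f := fun k x => g k x ^ (n + 1))
      (fun k => (g k).continuous.pow _)
      (fun k => (hgc k).comp_left (g := fun y : ℝ => y ^ (n + 1)) (by simp))
      (fun k x => pow_nonneg (hg01 k x).1 _) fun k => (t k : ℝ)
  have hfacts := fun (ω : PointConfig X) (k : κ) =>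
    sumFn_pow_succ_facts ω (hgK k) (hgc k) (hg01 k) (t k)
  have hmono : Monotone A := by
    intro m n hmn ω hω
    simp only [hA, mem_setOf_eq] at hω ⊢
    exact fun k => lt_of_le_of_lt ((hfacts ω k).1 hmn) (hω k)
  have hU : (⋃ n, A n) = {ω | ∀ k, ω.count (K k) < (t k : ℕ∞)} := by
    ext ω
    simp only [mem_iUnion, hA, mem_setOf_eq]
    constructor
    · rintro ⟨n, hn⟩ k
      exact (hfacts ω k).2.1 n (hn k)
    · intro hω
      exact (eventually_all.2 fun k => (hfacts ω k).2.2 (hω k)).exists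
  rw [← hU, hmono.measure_iUnion, hmono.measure_iUnion]
  exact iSup_congr hAeq

end Laplace

/-! ## The registered stub -/

/-- **THE LAPLACE FUNCTIONAL DETERMINES THE LAW OF A POINT PROCESS** (Kallenberg, *Foundations of Modern
Probability* (2002), Lemma 12.1, on the tree's `PointConfig X` with its count σ-algebra; registered stub
`stub_laplaceFunctionalDeterminesLaw` of line `FirstLemma`, crux stmt-AtomisticToContinuum-14135 — the unfolded
body of the named fact `LaplaceFunctionalDeterminesLaw`). Two finite laws on the locally finite simple
configurations of a locally compact, second countable Hausdorff space whose Laplace functionals agree on all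
continuous compactly supported `f ≥ 0` are equal: they have the same mass (`f = 0`) and agree on the compact count
events (`measure_compactCountEvent_eq`), a π-system generating the count σ-algebra
(`generateFrom_compactCountEvents`). [cite: Kallenberg2002, Lemma 12.1] -/
theorem stub_laplaceFunctionalDeterminesLaw :
    ∀ (X : Type) [TopologicalSpace X] [T2Space X] [LocallyCompactSpace X] [SecondCountableTopology X]
      [MeasurableSpace X] [BorelSpace X]
      {μ ν : MeasureTheory.Measure (Literature.Analysis.FunctionSpaces.PointConfig X)}
      [MeasureTheory.IsFiniteMeasure μ] [MeasureTheory.IsFiniteMeasure ν],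
      (∀ f : X → ℝ, Continuous f → HasCompactSupport f → (∀ x, 0 ≤ f x) →
        Literature.MathematicalPhysics.KineticTheory.PointProcess.laplaceFunctional μ f =
          Literature.MathematicalPhysics.KineticTheory.PointProcess.laplaceFunctional ν f) → μ = ν := by
  intro X _ _ _ _ _ _ μ ν _ _ hL
  have huniv : μ univ = ν univ := by
    have h := hL 0 continuous_zero HasCompactSupport.zero fun _ => le_rfl
    rw [laplaceFunctional_zero, laplaceFunctional_zero, measureReal_def, measureReal_def] at h
    exact (ENNReal.toReal_eq_toReal_iff' (measure_ne_top μ _) (measure_ne_top ν _)).1 h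
  refine ext_of_generate_finite _ generateFrom_compactCountEvents.symm isPiSystem_compactCountEvents
    (fun A hA => ?_) huniv
  obtain ⟨κ, hκ, K, t, hK, rfl⟩ := hA
  exact measure_compactCountEvent_eq hL hK t

end Literature.MathematicalPhysics.KineticTheory.PointProcess.LaplaceUniqueness

end Part2

/-! ## Part 3 — the EXACT discharge `LaplaceFunctionalDeterminesLaw_holds` -/

namespace Literature.MathematicalPhysics.KineticTheory.PointProcess

/-- **Kallenberg 2002, Lemma 12.1 (i) — the named fact `LaplaceFunctionalDeterminesLaw` HOLDS**: on a locally compact second countable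
Hausdorff space, two finite laws on simple locally finite configurations with the same Laplace functional on `C_c⁺` coincide.  EXACT-name
discharge by `LaplaceUniqueness.stub_laplaceFunctionalDeterminesLaw` (Stone–Weierstrass on `[0,1]^m`, counts of compact sets as monotone
limits, π-λ on count cylinders); Literature-side twin of the Summits-side
`Summit.AtomisticToContinuum.HydrodynamicLimit.Theorems.KiferCompactification.laplaceFunctionalDeterminesLaw_holds`.
[cite: Kallenberg2002, Lemma 12.1] -/
theorem LaplaceFunctionalDeterminesLaw_holds : LaplaceFunctionalDeterminesLaw := by
  unfold LaplaceFunctionalDeterminesLaw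
  exact LaplaceUniqueness.stub_laplaceFunctionalDeterminesLaw

end Literature.MathematicalPhysics.KineticTheory.PointProcess

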